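import Summits.HodgeConjecture.CorCM.Census.QuarticInversionFunctionals

/-!
# The quartic inversion twists, VIII: residual labels and how the weights read them

COR-CM (cell `pub-hodgecm2`, stage 2 of the Hodge ladder), count-neutral KERNEL COMBINATORICS by the binder seat b23 (gen 44; claim
QUARTIC-INVERSION, HOME/INBOX.md l.12829).  Part VIII of the lane `Census/QuarticInversion*`, on top of parts I–VII and seat b09's slice
(`eq_zero_or_eq_delta_of_wt_le_one`, `wt_zero`, `wt_delta`, `wt_add_one`), all BY NAME.  Theorems only; no `decide` table, no certificate, no named
fact, no geometry, no `sorry`.  `Interfaces.lean` (C1), every E term, B01, `Transposition/*`, `PortJoin/*` untouched.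
HONEST FRAMING: `HC_CM` is NOT proved, here or anywhere in the tree; nothing here is a period, a count of record or a headline.

CONTENT (`|B| ≥ 3` where stated).
* §1 Slice labels of class `≤ 1`: class `0` = the constants `0`, `𝟙` (told apart by their half), class `1` = the atoms `δ_u` (light, low) and
  `𝟙 + δ_u` (heavy, up); an up label of class `≤ 1` with bit `u` zero IS `𝟙 + δ_u`; a RESIDUAL quadruple (`pot₄ ≤ 1`) has at most one atom
  coordinate, the others constant.
* §2 On residual labels the weights of part VII read single labels: `wA j η u Φ = 1` forces `coord j Φ = 𝟙 + δ_u` and the other (constant)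
  coordinates to be the constants of halves `η` — so AT MOST ONE residual label carries a given atom weight (`residual_eq_of_wA`), and a given constant
  weight `wC η` is carried by exactly one constant label (`constant_eq_of_wC`).
Part IX (`…KeyLemma`) draws the key lemma from this.  All [folklore].

## References
* [Pohlmann1968] H. Pohlmann, Algebraic cycles on abelian varieties of complex multiplication type, Ann. of Math. 88 (1968), Thm 1.
-/

namespace Summit.HodgeConjecture.CorCM.Census.QuarticInversion

open Finset
open Summit.HodgeConjecture.CorCM.Census.OddSliceFacesModel
open Summit.HodgeConjecture.CorCM.Census.OddSliceFacesSquares (clsTy)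
open Summit.HodgeConjecture.CorCM.Census.OddSliceFacesDescent (wt_zero wt_delta)
open Summit.HodgeConjecture.CorCM.Census.DicyclicTwist (Ty₂)

noncomputable section

variable (A : Type) [AddCommGroup A] [Fintype A] [DecidableEq A]

/-! ## §1 Slice labels of class at most one -/

omit [AddCommGroup A] in
/-- **Class `0` = constants.** [folklore] -/
theorem eq_zero_or_one_of_clsTy_eq_zero {ψ : Ty A} (h : clsTy A ψ = 0) : ψ = 0 ∨ ψ = 1 := by
  have hw := wt_le A ψ
  unfold clsTy at h
  rcases Nat.le_total (wt A ψ) (Fintype.card A - wt A ψ) with hle | hle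
  · rw [min_eq_left hle] at h
    rcases eq_zero_or_eq_delta_of_wt_le_one A (χ := ψ) (by omega) with h0 | ⟨s, hs⟩
    · exact Or.inl h0
    · rw [hs, wt_delta] at h; exact absurd h one_ne_zero
  · rw [min_eq_right hle] at h
    have h1 : wt A (ψ + 1) = 0 := by rw [wt_add_one]; exact h
    rcases eq_zero_or_eq_delta_of_wt_le_one A (χ := ψ + 1) (by omega) with h0 | ⟨s, hs⟩
    · right
      have e : ψ = ψ + 1 + 1 := (add_one_add_one A ψ).symm
      rw [h0, zero_add] at e
      exact e
    · rw [hs, wt_delta] at h1; exact absurd h1 one_ne_zero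

omit [AddCommGroup A] in
/-- **Class `1` = atoms**: `δ_u` or `𝟙 + δ_u`. [folklore] -/
theorem exists_of_clsTy_eq_one {ψ : Ty A} (h : clsTy A ψ = 1) : ∃ u, ψ = δ A u ∨ ψ = 1 + δ A u := by
  have hw := wt_le A ψ
  unfold clsTy at h
  rcases Nat.le_total (wt A ψ) (Fintype.card A - wt A ψ) with hle | hle
  · rw [min_eq_left hle] at h
    rcases eq_zero_or_eq_delta_of_wt_le_one A (χ := ψ) (by omega) with h0 | ⟨s, hs⟩
    · rw [h0, wt_zero] at h; exact absurd h zero_ne_one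
    · exact ⟨s, Or.inl hs⟩
  · rw [min_eq_right hle] at h
    have h1 : wt A (ψ + 1) = 1 := by rw [wt_add_one]; exact h
    rcases eq_zero_or_eq_delta_of_wt_le_one A (χ := ψ + 1) (by omega) with h0 | ⟨s, hs⟩
    · rw [h0, wt_zero] at h1; exact absurd h1 zero_ne_one
    · refine ⟨s, Or.inr ?_⟩
      have e : ψ = ψ + 1 + 1 := (add_one_add_one A ψ).symm
      rw [hs] at e
      rw [e, add_comm]

omit [AddCommGroup A] [DecidableEq A] in
/-- The weight of `𝟙`. [folklore] -/
theorem wt_one : wt A (1 : Ty A) = Fintype.card A := by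
  have := wt_add_one A (0 : Ty A); rw [zero_add, wt_zero] at this; omega

omit [AddCommGroup A] in
/-- The weight of a heavy atom. [folklore] -/
theorem wt_one_add_delta (u : A) : wt A (1 + δ A u) = Fintype.card A - 1 := by
  rw [add_comm, wt_add_one, wt_delta]

omit [AddCommGroup A] [DecidableEq A] in
/-- `half 0 = true`. [folklore] -/
@[simp] theorem half_zero' : half A (0 : Ty A) = true := by
  unfold half; rw [wt_zero]; simp

omit [AddCommGroup A] [DecidableEq A] in
/-- `half 𝟙 = false` (`|B| ≥ 1`). [folklore] -/
theorem half_one (h1 : 1 ≤ Fintype.card A) : half A (1 : Ty A) = false := by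
  unfold half; rw [wt_one]; simp; omega

omit [AddCommGroup A] in
/-- `half (δ u) = true` (`|B| ≥ 2`). [folklore] -/
theorem half_delta (h2 : 2 ≤ Fintype.card A) (u : A) : half A (δ A u) = true := by
  unfold half; rw [wt_delta]; simp; omega

omit [AddCommGroup A] in
/-- `half (𝟙 + δ u) = false` (`|B| ≥ 3`). [folklore] -/
theorem half_one_add_delta (h3 : 3 ≤ Fintype.card A) (u : A) : half A (1 + δ A u) = false := by
  unfold half; rw [wt_one_add_delta]; simp; omega

omit [AddCommGroup A] in
/-- **A constant is determined by its half.** [folklore] -/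
theorem eq_of_clsTy_eq_zero_of_half_eq (h1 : 1 ≤ Fintype.card A) {ψ ψ' : Ty A} (h0 : clsTy A ψ = 0) (h0' : clsTy A ψ' = 0)
    (hh : half A ψ = half A ψ') : ψ = ψ' := by
  rcases eq_zero_or_one_of_clsTy_eq_zero A h0 with rfl | rfl <;> rcases eq_zero_or_one_of_clsTy_eq_zero A h0' with rfl | rfl
  · rfl
  · rw [half_zero', half_one A h1] at hh; exact absurd hh (by decide)
  · rw [half_zero', half_one A h1] at hh; exact absurd hh (by decide)
  · rfl

omit [AddCommGroup A] in
/-- **An up label of class `≤ 1` with bit `u` equal to `0` is the heavy atom `𝟙 + δ_u`** (`|B| ≥ 2`). [folklore] -/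
theorem eq_one_add_delta (h2 : 2 ≤ Fintype.card A) {ψ : Ty A} (hc : clsTy A ψ ≤ 1) (hup : half A ψ = false) {u : A} (hu : ψ u = 0) :
    ψ = 1 + δ A u := by
  rcases Nat.lt_or_ge (clsTy A ψ) 1 with h0 | h1
  · rcases eq_zero_or_one_of_clsTy_eq_zero A (show clsTy A ψ = 0 by omega) with rfl | rfl
    · rw [half_zero'] at hup; exact absurd hup (by decide)
    · exact absurd hu (by simp)
  · obtain ⟨u', h | h⟩ := exists_of_clsTy_eq_one A (le_antisymm hc h1)
    · rw [h, half_delta A h2] at hup; exact absurd hup (by decide)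
    · rw [h]
      rw [h, Pi.add_apply, Pi.one_apply, delta_apply] at hu
      by_cases huu : u = u'
      · rw [huu]
      · rw [if_neg huu, add_zero] at hu; exact absurd hu one_ne_zero

omit [AddCommGroup A] [DecidableEq A] in
/-- Residual labels have all classes `≤ 1`. [folklore] -/
theorem clsTy_coord_le_one {Θ : Ty₄ A} (h : pot₄ A Θ ≤ 1) (k : Fin 4) : clsTy A (coord A k Θ) ≤ 1 := by
  rw [pot₄_eq_sum] at h
  exact (Finset.single_le_sum (fun i _ => Nat.zero_le _) (Finset.mem_univ k)).trans h

omit [AddCommGroup A] [DecidableEq A] in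
/-- A residual label has at most one atom coordinate. [folklore] -/
theorem clsTy_coord_eq_zero_of_ne {Θ : Ty₄ A} (h : pot₄ A Θ ≤ 1) {j k : Fin 4} (hj : clsTy A (coord A j Θ) = 1) (hk : k ≠ j) :
    clsTy A (coord A k Θ) = 0 := by
  rw [pot₄_eq_sum, ← Finset.add_sum_erase _ _ (Finset.mem_univ j), hj] at h
  have := Finset.single_le_sum (fun i _ => Nat.zero_le (clsTy A (coord A i Θ))) (Finset.mem_erase.mpr ⟨hk, Finset.mem_univ k⟩)
  omega

/-! ## §2 The weights on residual labels -/

omit [AddCommGroup A] [DecidableEq A] in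
/-- `wA ∈ {0, 1}`; it is `1` iff the halves off `j` follow `η`, coordinate `j` is up and its bit `u` vanishes. [folklore] -/
theorem wA_eq_one_iff (j : Fin 4) (η : Fin 4 → Bool) (u : A) (Φ : Ty₄ A) :
    wA A j η u Φ = 1 ↔ (∀ i, i ≠ j → half A (coord A i Φ) = η i) ∧ half A (coord A j Φ) = false ∧ coord A j Φ u = 0 := by
  unfold wA wMatch wUp
  by_cases h1 : ∀ i, i ≠ j → half A (coord A i Φ) = η i <;> by_cases h2 : half A (coord A j Φ) = false ∧ coord A j Φ u = 0 <;>
    simp [h1, h2]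

omit [AddCommGroup A] [DecidableEq A] in
/-- `wA ≠ 0 → wA = 1`. [folklore] -/
theorem wA_eq_one_of_ne_zero {j : Fin 4} {η : Fin 4 → Bool} {u : A} {Φ : Ty₄ A} (h : ¬ wA A j η u Φ = 0) : wA A j η u Φ = 1 := by
  revert h
  unfold wA wMatch wUp
  by_cases h1 : ∀ i, i ≠ j → half A (coord A i Φ) = η i <;> by_cases h2 : half A (coord A j Φ) = false ∧ coord A j Φ u = 0 <;>
    simp [h1, h2]

omit [AddCommGroup A] in
/-- **At most one residual label carries a given atom weight**: if `wA j η u Φ = 1 = wA j η u Φ'` for residual `Φ, Φ'` then `Φ = Φ'` (`|B| ≥ 2`).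
[folklore] -/
theorem residual_eq_of_wA (h2 : 2 ≤ Fintype.card A) {j : Fin 4} {η : Fin 4 → Bool} {u : A} {Φ Φ' : Ty₄ A} (hΦ : pot₄ A Φ ≤ 1)
    (hΦ' : pot₄ A Φ' ≤ 1) (h : wA A j η u Φ = 1) (h' : wA A j η u Φ' = 1) : Φ = Φ' := by
  rw [wA_eq_one_iff] at h h'
  have hj : coord A j Φ = 1 + δ A u := eq_one_add_delta A h2 (clsTy_coord_le_one A hΦ j) h.2.1 h.2.2
  have hj' : coord A j Φ' = 1 + δ A u := eq_one_add_delta A h2 (clsTy_coord_le_one A hΦ' j) h'.2.1 h'.2.2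
  have hc1 : clsTy A (1 + δ A u) = 1 := by
    unfold clsTy; rw [wt_one_add_delta]; omega
  refine ext_coord A fun k => ?_
  by_cases hk : k = j
  · rw [hk, hj, hj']
  · refine eq_of_clsTy_eq_zero_of_half_eq A (le_trans one_le_two h2) (clsTy_coord_eq_zero_of_ne A hΦ (by rw [hj, hc1]) hk)
      (clsTy_coord_eq_zero_of_ne A hΦ' (by rw [hj', hc1]) hk) ?_
    rw [h.1 k hk, h'.1 k hk]

omit [AddCommGroup A] [DecidableEq A] in
/-- `wC ∈ {0,1}`; it is `1` iff all halves follow `η`. [folklore] -/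
theorem wC_eq_one_iff (η : Fin 4 → Bool) (Φ : Ty₄ A) : wC A η Φ = 1 ↔ ∀ i, half A (coord A i Φ) = η i := by
  unfold wC; by_cases h : ∀ i, half A (coord A i Φ) = η i <;> simp [h]

omit [AddCommGroup A] [DecidableEq A] in
/-- `wC ≠ 0 → wC = 1`. [folklore] -/
theorem wC_eq_one_of_ne_zero {η : Fin 4 → Bool} {Φ : Ty₄ A} (h : ¬ wC A η Φ = 0) : wC A η Φ = 1 := by
  revert h
  unfold wC; by_cases h : ∀ i, half A (coord A i Φ) = η i <;> simp [h]

omit [AddCommGroup A] in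
/-- **A constant label is determined by its halves**: `wC η Φ = 1 = wC η Φ'` for constant `Φ, Φ'` forces `Φ = Φ'` (`|B| ≥ 1`). [folklore] -/
theorem constant_eq_of_wC (h1 : 1 ≤ Fintype.card A) {η : Fin 4 → Bool} {Φ Φ' : Ty₄ A} (hΦ : pot₄ A Φ = 0) (hΦ' : pot₄ A Φ' = 0)
    (h : wC A η Φ = 1) (h' : wC A η Φ' = 1) : Φ = Φ' := by
  rw [wC_eq_one_iff] at h h'
  have hz : ∀ k, clsTy A (coord A k Φ) = 0 := fun k => by
    have h0 := hΦ; rw [pot₄_eq_sum] at h0; exact (Finset.sum_eq_zero_iff.mp h0) k (Finset.mem_univ k)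
  have hz' : ∀ k, clsTy A (coord A k Φ') = 0 := fun k => by
    have h0 := hΦ'; rw [pot₄_eq_sum] at h0; exact (Finset.sum_eq_zero_iff.mp h0) k (Finset.mem_univ k)
  exact ext_coord A fun k => eq_of_clsTy_eq_zero_of_half_eq A h1 (hz k) (hz' k) (by rw [h k, h' k])

end

end Summit.HodgeConjecture.CorCM.Census.QuarticInversion
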